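import Summits.Ventures.PercRepro.GenQRankStepBounds
import Summits.Ventures.PercRepro.GenQFlatLatticeT

/-!
# PercRepro — the rank-`6` rows on the core: the rank-`6` `k`-subsets of a subset of a rank-`6` flat (night-4, gen 20)

The `r = 6` instances of `card_rkSets_top_ge` (GenQRankStepBounds) with the core chain `fCore = 3, 3, 3, 6, 10, 21, 43`
built from the explicit flat bounds (`sizeChain_of_flats`, `q = 7`): in an `s`-point subset `X` of a rank-`6` flat,
* `30·C(s, 6) ≤ 30·N_{6,6} + 3·C(s, 3) + 75·C(s, 4) + 160·C(s, 5)` (`thirty_mul_choose_six_le_six`),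
* `C(s, 7) ≤ N_{6,7} + 2·C(s, 4) + 20·C(s, 5)` (`choose_seven_le_six`),
* `C(s, 8) ≤ N_{6,8} + C(s, 4) + 56·C(s, 5)` (`choose_eight_le_six`),
the rank-`6` twins of `two_mul_choose_five_le` / `twenty_mul_choose_six_le` (rank `5`) — the Lean facts behind the rank-`6`
kappa rows of the `(10, 8)` type-layer LP at `q = 8` (`S7q6`: `Σ_s κ(6,6,s)·NR 6 s ≤ C(n, 6)` by `sum_flats_kappa_le`; the
`(G-D)` rho terms at `j = 7, 8`). Imports `GenQRankStepBounds`, `GenQFlatLatticeT`.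
-/
namespace PercRepro.Night4

open Finset ThmH SixFour GenQ PerFlat Star

variable {α : Type} [DecidableEq α] {M : Matroid α} [M.Finite]

/-- The core chain up to rank `6` from the explicit flat bounds: `SizeChain M 7 fCore`. -/
theorem sizeChain_seven_of_flats (hs : Simple M) (hline : ∀ L ∈ flatsQ M 2, L.card ≤ 3)
    (hplane : ∀ P ∈ flatsQ M 3, P.card ≤ 6) (hsolid : ∀ F ∈ flatsQ M 4, F.card ≤ 10)
    (hflat5 : ∀ F ∈ flatsQ M 5, F.card ≤ 21) (hflat6 : ∀ F ∈ flatsQ M 6, F.card ≤ 43) :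
    SizeChain M 7 fCore := by
  refine sizeChain_of_flats fCore_mono (fun r hr F hF => ?_)
  rcases (show r = 0 ∨ r = 1 ∨ r = 2 ∨ r = 3 ∨ r = 4 ∨ r = 5 ∨ r = 6 by omega) with h | h | h | h | h | h | h <;>
    subst h
  · exact (card_le_one_of_flatsQ_le_one hs (by norm_num) hF).trans (by decide)
  · exact (card_le_one_of_flatsQ_le_one hs (by norm_num) hF).trans (by decide)
  · exact hline F hF
  · exact hplane F hF
  · exact hsolid F hF
  · exact hflat5 F hF
  · exact hflat6 F hF

/-- **`30·C(s, 6) ≤ 30·N_{6,6} + 3·C(s, 3) + 75·C(s, 4) + 160·C(s, 5)`** for `X ⊆ F ∈ flatsQ M 6` on the core (`s = |X|`). -/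
theorem thirty_mul_choose_six_le_six (hs : Simple M) (hline : ∀ L ∈ flatsQ M 2, L.card ≤ 3)
    (hplane : ∀ P ∈ flatsQ M 3, P.card ≤ 6) (hsolid : ∀ F ∈ flatsQ M 4, F.card ≤ 10)
    (hflat5 : ∀ F ∈ flatsQ M 5, F.card ≤ 21) (hflat6 : ∀ F ∈ flatsQ M 6, F.card ≤ 43) {X F : Finset α}
    (hF : F ∈ flatsQ M 6) (hXF : X ⊆ F) :
    30 * X.card.choose 6 ≤ 30 * (rkSets M X 6 6).card + 3 * X.card.choose 3 + 75 * X.card.choose 4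
      + 160 * X.card.choose 5 := by
  have hX : X ⊆ gr M := hXF.trans (mem_flatsQ.1 hF).1
  have h := card_rkSets_top_ge hs (sizeChain_seven_of_flats hs hline hplane hsolid hflat5 hflat6) hF hXF hX
    (by norm_num) (by norm_num) (k := 6) (by norm_num) (by decide)
  simp only [Finset.sum_Ico_eq_sum_range, Finset.prod_Ico_eq_prod_range] at h
  norm_num [Finset.sum_range_succ, Finset.prod_range_succ, show fCore 5 = 21 from rfl, show fCore 4 = 10 from rfl,
    show fCore 1 = 3 from rfl, show fCore 2 = 3 from rfl, show fCore 3 = 6 from rfl] at h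
  have h' : (30 : ℚ) * X.card.choose 6 ≤ 30 * (rkSets M X 6 6).card + 3 * X.card.choose 3 + 75 * X.card.choose 4
      + 160 * X.card.choose 5 := by
    linarith
  exact_mod_cast h'

/-- **`C(s, 7) ≤ N_{6,7} + 2·C(s, 4) + 20·C(s, 5)`** for `X ⊆ F ∈ flatsQ M 6` on the core. -/
theorem choose_seven_le_six (hs : Simple M) (hline : ∀ L ∈ flatsQ M 2, L.card ≤ 3)
    (hplane : ∀ P ∈ flatsQ M 3, P.card ≤ 6) (hsolid : ∀ F ∈ flatsQ M 4, F.card ≤ 10)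
    (hflat5 : ∀ F ∈ flatsQ M 5, F.card ≤ 21) (hflat6 : ∀ F ∈ flatsQ M 6, F.card ≤ 43) {X F : Finset α}
    (hF : F ∈ flatsQ M 6) (hXF : X ⊆ F) :
    X.card.choose 7 ≤ (rkSets M X 6 7).card + 2 * X.card.choose 4 + 20 * X.card.choose 5 := by
  have hX : X ⊆ gr M := hXF.trans (mem_flatsQ.1 hF).1
  have h := card_rkSets_top_ge hs (sizeChain_seven_of_flats hs hline hplane hsolid hflat5 hflat6) hF hXF hX
    (by norm_num) (by norm_num) (k := 7) (by norm_num) (by decide)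
  simp only [Finset.sum_Ico_eq_sum_range, Finset.prod_Ico_eq_prod_range] at h
  norm_num [Finset.sum_range_succ, Finset.prod_range_succ, show fCore 5 = 21 from rfl, show fCore 4 = 10 from rfl,
    show fCore 1 = 3 from rfl, show fCore 2 = 3 from rfl, show fCore 3 = 6 from rfl] at h
  have h' : (X.card.choose 7 : ℚ) ≤ (rkSets M X 6 7).card + 2 * X.card.choose 4 + 20 * X.card.choose 5 := by
    linarith
  exact_mod_cast h'

/-- **`C(s, 8) ≤ N_{6,8} + C(s, 4) + 56·C(s, 5)`** for `X ⊆ F ∈ flatsQ M 6` on the core. -/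
theorem choose_eight_le_six (hs : Simple M) (hline : ∀ L ∈ flatsQ M 2, L.card ≤ 3)
    (hplane : ∀ P ∈ flatsQ M 3, P.card ≤ 6) (hsolid : ∀ F ∈ flatsQ M 4, F.card ≤ 10)
    (hflat5 : ∀ F ∈ flatsQ M 5, F.card ≤ 21) (hflat6 : ∀ F ∈ flatsQ M 6, F.card ≤ 43) {X F : Finset α}
    (hF : F ∈ flatsQ M 6) (hXF : X ⊆ F) :
    X.card.choose 8 ≤ (rkSets M X 6 8).card + X.card.choose 4 + 56 * X.card.choose 5 := by
  have hX : X ⊆ gr M := hXF.trans (mem_flatsQ.1 hF).1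
  have h := card_rkSets_top_ge hs (sizeChain_seven_of_flats hs hline hplane hsolid hflat5 hflat6) hF hXF hX
    (by norm_num) (by norm_num) (k := 8) (by norm_num) (by decide)
  simp only [Finset.sum_Ico_eq_sum_range, Finset.prod_Ico_eq_prod_range] at h
  norm_num [Finset.sum_range_succ, Finset.prod_range_succ, show fCore 5 = 21 from rfl, show fCore 4 = 10 from rfl,
    show fCore 1 = 3 from rfl, show fCore 2 = 3 from rfl, show fCore 3 = 6 from rfl] at h
  have h' : (X.card.choose 8 : ℚ) ≤ (rkSets M X 6 8).card + X.card.choose 4 + 56 * X.card.choose 5 := by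
    linarith
  exact_mod_cast h'

end PercRepro.Night4
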